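import Summits.NavierStokesRegularity.FluidComputer.RowCircuitTime
import Summits.NavierStokesRegularity.FluidComputer.RowSection
import HarnessLib

/-!
# `RowCircuitSection`: the scale-induction READ-OUT of the certified circuit at its own section
# crossing — the member lands in the induction box `B′` (`pub-fluidc-bp3/R1-DESIGN.md` §12)

HONEST FRAMING (cell `pub-fluidc`, blueprint seat bp3, gen 23): low prior, high value-of-information
experiment on Tao's machine paradigm; NOT a claim that NS blows up. No fluid mechanics and no new
mathematics: the chain of record (`RowChain`, `chain_members`), the section read-out certificate
(`RowSection.sectionOK`, decided here on rows `1064 | 1065` by `native_decide`) and bookkeeping.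

WHAT. `I(n) ⇒ I(n+1)` in box form. The induction box `B′` is read in the coordinates the chain's own
start box is written in: at the crossing of the section `π(v) = v_{b₂} − ρ v_{a₂} = 0`,
`ρ := X0_{b₁} / X0_{a₁}` (the slope of the start point `X0` in the `(a₁, b₁)` plane, transported to
the next gate's `(a₂, b₂)` plane), the level `ℓ′ := v_{b₂} / X0_{b₁}` (`= v_{a₂} / X0_{a₁}`) and the
three ratios `X0_{b₁} v_i / v_{b₂} = X0_{a₁} v_i / v_{a₂}`, `i = c₂, d₂, e₂`, i.e. the next step's
`c₁, d₁` and spent-gate coordinate `z`, rescaled to level `1`. **`secCert`** is the box of record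
`B′ = ctr ± wid` (centre = the gen-19 box `PostBox18L`'s centre; half-widths `× (1, 5/4, 5/2)` in
`(c, d, z)`), the level range `[0.9673, 0.9718]` and `M = 16` pieces per window row;
**`section_cert : sectionOK (row 1064) (row 1065) secCert = true`**. **`circuit_section_from`**: the
exact circuit from ANY admissible start (`q₀` locked on `b₁` with frame coordinates in row `0`'s start
box) crosses the section at a physical time `τ`, `|τ − 19/20| ≤ 3/500`, with positive carrier, level
`ℓ′ ∈ [0.9673, 0.9718]` and `(c, d, z)`-read-out in `B′`. What this file does NOT do: re-enter — that
`B′` (with the quiet modes in `Q1`) maps back into row `0`'s start box is the arithmetic fact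
`reentryOK` of the chain certified FROM `B′` (kernel table k54, `R1-DESIGN.md` §12.4), not of the chain
of record k53d (certified from the narrower `PostBox18L`); the loop closes in `RowCircuitReentry` on
that chain.

[cite: Tao2016AveragedNS, §5.5 Thm 5.3 (5.5)]
-/

namespace Summit.NavierStokesRegularity.FluidComputer

open Literature.Analysis.FluidPDE.FluidComputer

namespace RowChain

open RowCheck RowCheck.RowData RowRun ChainField Set

/-- **The induction box of record `B′`** (exact dyadic rationals of the kernel table k54's start
half-widths; centre = `PostBox18L`'s), the section slope `ρ = X0_{b₁}/X0_{a₁}`, the level unit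
`X0_{b₁}`, the level range and `M = 16`. [folklore] -/
def secCert : SecCert where
  rho := X0Q 1 / X0Q 0
  bmid := X0Q 1
  ctr := ![926457990491 / 2 ^ 57, 966669849226149 / 2 ^ 59, 5381485300560447 / 2 ^ 59]
  wid := ![5 / 2 ^ 25, 2437644803610613 / 2 ^ 64, 3447350341514429 / 2 ^ 63]
  levLo := 9673 / 10000
  levHi := 9718 / 10000
  M := 16

set_option maxHeartbeats 10000000 in
/-- **The section read-out certificate holds on the window rows `1064 | 1065` of the chain of
record.** [folklore] -/
theorem section_cert : sectionOK (row 1064) (row 1065) secCert = true := by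
  native_decide

/-- The window rows are short and slow: `H₁₀₆₄ + H₁₀₆₅ + 3(ρH)₁₀₆₄ + 3(ρH)₁₀₆₅ ≤ 11/10000`.
[folklore] -/
theorem windowQ :
    (row 1064).Hq + (row 1065).Hq +
      3 * (((row 1064).ph'.rho : ℚ) / 2 ^ (row 1064).P * (row 1064).Hq) +
      3 * (((row 1065).ph'.rho : ℚ) / 2 ^ (row 1065).P * (row 1065).Hq) ≤ 11 / 10000 := by
  native_decide

/-- Per-row time at any instant of the row: `|s(t) − s(T₀) − (t − T₀)| ≤ ρ (t − T₀)`. [folklore] -/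
theorem row_time_at {R : RowModel (Fin 8) (Fin 9)} {Ts : ℝ} (hm : R.MemberOn Ts)
    {ρ : ℝ} (hrate : ∀ t ∈ Ico R.T₀ Ts, |R.sd t - 1| ≤ ρ) {t : ℝ} (ht : t ∈ Icc R.T₀ Ts) :
    |R.s t - R.s R.T₀ - (t - R.T₀)| ≤ ρ * (t - R.T₀) := by
  have h := norm_image_sub_le_of_norm_deriv_right_le_segment (f := fun t => R.s t - t)
    (f' := fun t => R.sd t - 1) (hm.hsc.sub continuousOn_id)
    (fun t ht => (hm.hsd t ht).sub (hasDerivWithinAt_id _ _))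
    (fun t ht => by rw [Real.norm_eq_abs]; exact hrate t ht) t ht
  rw [Real.norm_eq_abs] at h
  calc |R.s t - R.s R.T₀ - (t - R.T₀)| = |R.s t - t - (R.s R.T₀ - R.T₀)| := by ring_nf
    _ ≤ ρ * (t - R.T₀) := h

/-- **The exact circuit, read out at its own section crossing.** From any admissible start the
circuit crosses `v_{b₂} = ρ v_{a₂}` at a physical time `τ` with `|τ − 19/20| ≤ 3/500`; there the
carrier is positive, the level `v_{b₂}/X0_{b₁}` lies in `[0.9673, 0.9718]` and the three read-out
ratios lie in the induction box `B′`. [folklore] -/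
theorem circuit_section_from (q₀ : Fin 9 → ℝ) (hlock : q₀ (row 0).p = X0 (row 0).p)
    (hbox : ∀ i, |z0 q₀ i| ≤ (row 0).ubR 0 i) :
    ∃ y : ℝ → Fin 9 → ℝ, y 0 = q₀ ∧ (∀ σ, HasDerivAt y (F gK ΛK (y σ)) σ) ∧ ∃ τ : ℝ,
      |τ - 19 / 20| ≤ 3 / 500 ∧
      y τ 5 = (secCert.rho : ℝ) * y τ 4 ∧ 0 < y τ 4 ∧
      ((secCert.levLo : ℝ) ≤ y τ 5 / secCert.bmid ∧ y τ 5 / secCert.bmid ≤ secCert.levHi) ∧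
      ∀ j : Fin 3, |(secCert.bmid : ℝ) * y τ (rdIdx j) / y τ 5 - secCert.ctr j| ≤
        secCert.wid j := by
  obtain ⟨y, hy0, hsol⟩ := CircuitFlow.circuit_solution gK ΛK q₀
  have hyc : Continuous y := continuous_iff_continuousAt.2 fun σ => (hsol σ).continuousAt
  have hwin : ∀ (k k' : ℕ) (a : Fin 9), |(0 : ℝ → Fin 9 → ℝ) 0 a| ≤
      ((max ((row k).DEL a) ((row k').DEL a) : ℤ) : ℝ) / 2 ^ (row k').P :=
    fun k k' a => by
    rw [Pi.zero_apply, Pi.zero_apply, abs_zero]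
    exact div_nonneg (by exact_mod_cast (DEL_nonneg_row k a).trans (le_max_left _ _))
      (by positivity)
  obtain ⟨sA, sdA, sB, sdB, sD, sdD, hs0, hmem, ⟨S1⟩, ⟨S2⟩⟩ := chain_members Tc Tc_succ (y := y)
    (δF := 0) (D := univ) isOpen_univ
    (fun σ _ a => by simpa using (hasDerivAt_pi.1 (hsol σ)) a)
    (fun k _ => by
      have hc : Continuous fun σ => F gK ΛK (y σ) (row k).p :=
        (continuous_apply (row k).p).comp ((continuous_F gK ΛK).comp hyc)
      simpa using hc)
    (fun k _ σ _ t _ _ a => by simpa using δR_nonneg_row k a)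
    (fun K _ _ => subset_univ _)
    (fun σ _ _ => ⟨subset_univ _, fun ξ _ a => hwin 656 657 a⟩)
    (fun σ _ _ => ⟨subset_univ _, fun ξ _ a => hwin 986 987 a⟩)
    (σ₀ := 0) (mem_univ _) (by rw [hy0, hlock]; rfl)
    (fun i => by
      rw [z_start_eq_z0 (Tc 0) y 0 univ (fun _ => 0) (fun _ => 0) rfl hy0]
      exact hbox i)
  have hu0A : ∀ i, |(toModel (canon (framesOK_row 0)) (G 0) (Tc 0) ⟨y, 0, univ, sA, sdA⟩).z
      (Tc 0) i| ≤ (row 0).ubR 0 i := fun i => by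
    rw [z_start_eq_z0 (Tc 0) y 0 univ sA sdA hs0 hy0]
    exact hbox i
  have h := segAD Tc Tc_succ ⟨y, 0, univ, sA, sdA⟩ ⟨y, 0, univ, sB, sdB⟩ ⟨y, 0, univ, sD, sdD⟩
    (fun k hk => (hmem k hk).some) hu0A S1 S2
  -- the chain's clock up to the end of the last row
  have hrow : ∀ k < 1066, |(mOf ⟨y, 0, univ, sA, sdA⟩ ⟨y, 0, univ, sB, sdB⟩ ⟨y, 0, univ, sD, sdD⟩
      k).s (Tc (k + 1)) - (mOf ⟨y, 0, univ, sA, sdA⟩ ⟨y, 0, univ, sB, sdB⟩ ⟨y, 0, univ, sD, sdD⟩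
      k).s (Tc k) - (row k).Hq| ≤ (row k).rhoR * (row k).Hq := by
    intro k hk
    have hH : Tc (k + 1) - Tc k = (row k).Hq := by rw [Tc_succ k]; ring
    have hle : Tc k ≤ Tc (k + 1) := by
      have := Hq_pos ((runOK_iff _).mp (runOK_row k)).1
      linarith
    have h1 := row_time (hmem k hk).some hle (h k hk).2.2.2
    change |(mOf _ _ _ k).s (Tc (k + 1)) - (mOf _ _ _ k).s (Tc k) - (Tc (k + 1) - Tc k)| ≤
      (row k).rhoR * (Tc (k + 1) - Tc k) at h1
    rw [hH] at h1
    exact h1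
  have hclock := chain_time Tc (fun k => ((row k).Hq : ℝ)) (fun k => (row k).rhoR) Tc_succ sA sB
    sD hs0 (fun k hk => by have := hrow k (by omega); rwa [mOf_A hk] at this)
    (fun k hk hk' => by have := hrow k (by omega); rwa [mOf_B hk hk'] at this)
    (fun k hk hk' => by have := hrow k hk'; rwa [mOf_D hk] at this) S1.hσ S2.hσ
  rw [Tc_zero] at hclock
  -- the member on the window rows (segment D): continuity, tubes, per-row time
  set v : ℝ → Fin 9 → ℝ := fun t => y (sD t) with hv
  have hcont : ∀ k, 987 ≤ k → k < 1066 → ContinuousOn v (Icc (Tc k) (Tc (k + 1))) := by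
    intro k hk1 hk2
    have hm := (hmem k hk2).some
    rw [mOf_D hk1] at hm
    have hsc := hm.hsc
    change ContinuousOn sD (Icc (Tc k) (Tc (k + 1))) at hsc
    exact hyc.comp_continuousOn hsc
  have htube : ∀ k, 987 ≤ k → k < 1066 → ∀ t ∈ Icc (Tc k) (Tc (k + 1)), ∀ a,
      |v t a - xh (row k).CQ (t - Tc k) a| ≤ (row k).EbarR a := by
    intro k hk1 hk2 t ht a
    have h1 := (h k hk2).2.1 t ht a
    rw [mOf_D hk1] at h1
    exact h1
  have htime : ∀ k, 987 ≤ k → k < 1066 → ∀ t ∈ Icc (Tc k) (Tc (k + 1)),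
      |sD t - sD (Tc k) - (t - Tc k)| ≤ (row k).rhoR * (row k).Hq := by
    intro k hk1 hk2 t ht
    have hm := (hmem k hk2).some
    have hrate := (h k hk2).2.2.2
    rw [mOf_D hk1] at hm hrate
    have h1 := row_time_at hm hrate (t := t) ht
    change |sD t - sD (Tc k) - (t - Tc k)| ≤ (row k).rhoR * (t - Tc k) at h1
    have hρ : 0 ≤ (row k).rhoR := by
      have := hrate (Tc k) ⟨le_rfl, by
        have := Hq_pos ((runOK_iff _).mp (runOK_row k)).1
        rw [Tc_succ k]; linarith⟩
      exact (abs_nonneg _).trans this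
    have hH : t - Tc k ≤ (row k).Hq := by rw [Tc_succ k] at ht; linarith [ht.2]
    exact h1.trans (mul_le_mul_of_nonneg_left hH hρ)
  -- the section read-out
  obtain ⟨t, ht, hsec, hpos, hlev, hrat⟩ := section_sound section_cert (v := v) (Tc_succ 1064)
    (Tc_succ 1065) (hcont 1064 (by norm_num) (by norm_num)) (hcont 1065 (by norm_num) (by norm_num))
    (htube 1064 (by norm_num) (by norm_num)) (htube 1065 (by norm_num) (by norm_num))
  refine ⟨y, hy0, hsol, sD t, ?_, hsec, hpos, hlev, hrat⟩
  -- the clock at the crossing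
  obtain ⟨hS, hO, h19⟩ := time_budgetQ
  have hS' : ((∑ k ∈ Finset.range 1066, ((row k).ph'.rho : ℚ) / 2 ^ (row k).P * (row k).Hq : ℚ)
      : ℝ) ≤ ((1 / 600 : ℚ) : ℝ) := by exact_mod_cast hS
  have hO' : (((cert656.Ds : ℚ) / 2 ^ (row 657).P + (cert986.Ds : ℚ) / 2 ^ (row 987).P : ℚ) : ℝ)
      ≤ ((1 / 700 : ℚ) : ℝ) := by exact_mod_cast hO
  have h19' : ((|∑ k ∈ Finset.range 1066, (row k).Hq - 19 / 20| : ℚ) : ℝ) ≤ ((1 / 1000 : ℚ) : ℝ) :=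
    by exact_mod_cast h19
  have hw' := windowQ
  have hw : (((row 1064).Hq + (row 1065).Hq +
      3 * (((row 1064).ph'.rho : ℚ) / 2 ^ (row 1064).P * (row 1064).Hq) +
      3 * (((row 1065).ph'.rho : ℚ) / 2 ^ (row 1065).P * (row 1065).Hq) : ℚ) : ℝ) ≤
      ((11 / 10000 : ℚ) : ℝ) := by exact_mod_cast hw'
  push_cast at hS' hO' h19' hw
  have hsum : ∑ k ∈ Finset.range 1066, (row k).rhoR * (row k).Hq =
      ∑ k ∈ Finset.range 1066, ((row k).ph'.rho : ℝ) / 2 ^ (row k).P * (row k).Hq := rfl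
  have hTc : Tc 1066 = ∑ k ∈ Finset.range 1066, ((row k).Hq : ℝ) := rfl
  have hρ4 : (row 1064).rhoR = ((row 1064).ph'.rho : ℝ) / 2 ^ (row 1064).P := rfl
  have hρ5 : (row 1065).rhoR = ((row 1065).ph'.rho : ℝ) / 2 ^ (row 1065).P := rfl
  have hT5 : Tc 1065 = Tc 1064 + (row 1064).Hq := Tc_succ 1064
  have hT6 : Tc 1066 = Tc 1065 + (row 1065).Hq := Tc_succ 1065
  have hH4 : (0 : ℝ) < (row 1064).Hq := Hq_pos ((runOK_iff _).mp (runOK_row 1064)).1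
  have hH5 : (0 : ℝ) < (row 1065).Hq := Hq_pos ((runOK_iff _).mp (runOK_row 1065)).1
  -- |sD(Tc 1066) − Tc 1066| ≤ S + O
  have hend : |sD (Tc 1066) - Tc 1066| ≤ 1 / 600 + 1 / 700 := by
    have : |sD (Tc 1066) - 0 - (Tc 1066 - 0)| ≤ _ := hclock
    rw [sub_zero, sub_zero] at this
    rw [hsum] at this
    linarith
  -- row 1065 full, row 1064 full
  have h65 := htime 1065 (by norm_num) (by norm_num) (Tc 1066)
    ⟨by rw [hT6]; linarith, by change Tc 1066 ≤ Tc 1066; exact le_rfl⟩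
  have h64 := htime 1064 (by norm_num) (by norm_num) (Tc 1065)
    ⟨by rw [hT5]; linarith, by change Tc 1065 ≤ Tc 1065; exact le_rfl⟩
  have hρH4 : 0 ≤ (row 1064).rhoR * (row 1064).Hq := by
    have := htime 1064 (by norm_num) (by norm_num) (Tc 1064) ⟨le_rfl, by rw [hT5]; linarith⟩
    exact (abs_nonneg _).trans this
  have hρH5 : 0 ≤ (row 1065).rhoR * (row 1065).Hq := by
    have := htime 1065 (by norm_num) (by norm_num) (Tc 1065) ⟨le_rfl, by rw [hT6]; linarith⟩
    exact (abs_nonneg _).trans this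
  rw [hρ4] at h64 hρH4
  rw [hρ5] at h65 hρH5
  have ht2 : t ≤ Tc 1065 + (row 1065).Hq := by have := ht.2; rwa [Tc_succ 1065] at this
  have e1 := abs_le.mp hend
  have e2 := abs_le.mp h65
  have e3 := abs_le.mp h64
  have e5 := abs_le.mp h19'
  rw [← hTc] at e5
  by_cases htk : t ≤ Tc 1065
  · -- crossing in row 1064
    have hpart := htime 1064 (by norm_num) (by norm_num) t ⟨ht.1, htk⟩
    rw [hρ4] at hpart
    have e4 := abs_le.mp hpart
    rw [abs_le]; constructor <;> linarith [ht.1]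
  · -- crossing in row 1065
    have htk' : Tc 1065 < t := lt_of_not_ge htk
    have hpart := htime 1065 (by norm_num) (by norm_num) t ⟨htk'.le, ht.2⟩
    rw [hρ5] at hpart
    have e4 := abs_le.mp hpart
    rw [abs_le]; constructor <;> linarith

end RowChain

end Summit.NavierStokesRegularity.FluidComputer
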